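import Literature.Claims.NS.Alneel2026
import Literature.Analysis.FluidPDE.JiaSverak2013Lemma8SliceTools
import Summits.NavierStokesRegularity.NavierStokesRegularity.Theorems.SoloRefuteBledsoe2026Fields
import Mathlib.MeasureTheory.Measure.Haar.NormedSpace
import HarnessLib

/-!
# C156 `Alneel2026` — refuter kit (ns-claims-refuter-8 g4): Step 3 as printed fails in ℝ³ by dilation

`Literature.Claims.NS.Alneel2026.Step3_GN_asPrinted C` (Step 3, p. 2 l. 26–29 «Apply GN to v = uϕ in 3D:
‖v‖²_{L⁴} ≤ C_GN‖v‖_{L²}‖∇v‖_{L²}», typed at the functions grain with the printed exponents (1,1)) is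
false for EVERY real constant `C`: for the smooth compactly supported field `Φ` of the tree
(`…Theorems.Bledsoe2026.Φ`, the cut-off potential `χ·(x₂x₁, −x₂x₀, 0)`) and its dilates
`Φ_c(x) = Φ(c x)`, the three integrals scale as `∫|Φ_c|⁴ = c⁻³∫|Φ|⁴`, `∫|Φ_c|² = c⁻³∫|Φ|²`,
`∫|∇Φ_c|² = c⁻¹∫|∇Φ|²` (change of variables + chain rule), so the printed display would give
`c · ∫|Φ|⁴ ≤ C² ∫|Φ|² ∫|∇Φ|²` for every `c > 0` — impossible since `∫|Φ|⁴ > 0`. Hence also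
`¬ Step3_GN_asPrinted_ex`. These are the 2-D Ladyzhenskaya exponents written on ℝ³ (the two sides
have different dimensions, `ℓ^{3/2}` against `ℓ²`).

`Literature.Claims.NS.Alneel2026.Step_P3tail C` (Theorem 3.1, Point 3, p. 3 l. 28–49, typed at the
real-function grain as the implication the printed tail needs) is false for EVERY `C`: the profile
`ν = 1`, `E₀ = 2`, `T* = 1`, `X(s) = (1 − s)^{−1/2}`, `R(s) = √(32C/X(s))` (`R = 0` when `C < 0`) has
`∫₀ᵗ X = 2 − 2√(1−t) ≤ 2` (so (4)/Point 2 hold), `R²X ≡ 32C = 16·C·E₀` (the scale law AND the printed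
reverse law hold with equality), and `X → +∞` at `1⁻` — every hypothesis of the tail — so «R(s) ≥ c√(T*−s)
… X(s) ≤ C/(T*−s) … ∫X = ∞ … E(T*) < 0» does not follow (`not_Step_P3tail`); the abstract's inference
without the reverse law fails by the same profile (`not_Step_Thm31_inference`).

No statement about Navier–Stokes regularity or blow-up is made or used.
-/

noncomputable section

open MeasureTheory Set Filter Topology Metric
open scoped ENNReal ContDiff Topology

namespace Summit.NavierStokesRegularity.NavierStokesRegularity.Theorems.Alneel2026

open Literature.Claims.NS.Alneel2026 Literature.Analysis.FluidPDE
open Summit.NavierStokesRegularity.NavierStokesRegularity.Theorems.Bledsoe2026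
  (Φ Φ_contDiff Φ_hasCompactSupport A_apply_zero χ)

/-- The dilates `Φ_c(x) = Φ(c·x)` of the tree's compactly supported potential. -/
def dil (c : ℝ) : E3 → E3 := fun x => Φ (c • x)

/-- Each dilate is smooth. [folklore] -/
theorem dil_contDiff (c : ℝ) : ContDiff ℝ ∞ (dil c) :=
  Φ_contDiff.comp (contDiff_id.const_smul c)

/-- Each dilate (`c ≠ 0`) has compact support. [folklore] -/
theorem dil_hasCompactSupport {c : ℝ} (hc : c ≠ 0) : HasCompactSupport (dil c) :=
  Φ_hasCompactSupport.comp_smul hc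

/-- Chain rule for the dilates: `D(Φ_c)(x) = c · (DΦ)(c x)`. [folklore] -/
theorem fderiv_dil (c : ℝ) (x : E3) : fderiv ℝ (dil c) x = c • fderiv ℝ Φ (c • x) :=
  fderiv_comp_smul c

/-- `∫|Φ_c|⁴ = c⁻³ ∫|Φ|⁴` (`c > 0`). [folklore] -/
theorem int4_dil {c : ℝ} (hc : 0 < c) :
    ∫ x, ‖dil c x‖ ^ 4 = (c ^ 3)⁻¹ * ∫ x, ‖Φ x‖ ^ 4 := by
  have h := Measure.integral_comp_smul_of_nonneg volume (fun x : E3 => ‖Φ x‖ ^ 4) c (hR := hc.le)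
  have hfr : Module.finrank ℝ E3 = 3 := finrank_euclideanSpace_fin
  rw [hfr, smul_eq_mul] at h
  exact h

/-- `∫|Φ_c|² = c⁻³ ∫|Φ|²` (`c > 0`). [folklore] -/
theorem int2_dil {c : ℝ} (hc : 0 < c) :
    ∫ x, ‖dil c x‖ ^ 2 = (c ^ 3)⁻¹ * ∫ x, ‖Φ x‖ ^ 2 := by
  have h := Measure.integral_comp_smul_of_nonneg volume (fun x : E3 => ‖Φ x‖ ^ 2) c (hR := hc.le)
  have hfr : Module.finrank ℝ E3 = 3 := finrank_euclideanSpace_fin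
  rw [hfr, smul_eq_mul] at h
  exact h

/-- `∫|∇Φ_c|² = c² · c⁻³ ∫|∇Φ|²` (`c > 0`). [folklore] -/
theorem intD_dil {c : ℝ} (hc : 0 < c) :
    ∫ x, frobeniusNormSq (fderiv ℝ (dil c) x) =
      c ^ 2 * ((c ^ 3)⁻¹ * ∫ x, frobeniusNormSq (fderiv ℝ Φ x)) := by
  have h1 : (fun x => frobeniusNormSq (fderiv ℝ (dil c) x)) =
      fun x => c ^ 2 * frobeniusNormSq (fderiv ℝ Φ (c • x)) := by
    funext x; rw [fderiv_dil, frobeniusNormSq_smul_eq]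
  have h := Measure.integral_comp_smul_of_nonneg volume
    (fun x : E3 => frobeniusNormSq (fderiv ℝ Φ x)) c (hR := hc.le)
  have hfr : Module.finrank ℝ E3 = 3 := finrank_euclideanSpace_fin
  rw [hfr, smul_eq_mul] at h
  rw [h1, integral_const_mul, h]

/-- A point where `Φ ≠ 0`: `x⋆ = (0, ½, ½)`. -/
def xstar : E3 := (1 / 2 : ℝ) • (EuclideanSpace.single 1 1 + EuclideanSpace.single 2 1)

/-- `‖x⋆‖ ≤ 1`, so the cut-off equals `1` there. [folklore] -/
theorem norm_xstar_le : ‖xstar‖ ≤ 1 := by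
  rw [xstar, norm_smul]
  have h : ‖(EuclideanSpace.single 1 1 + EuclideanSpace.single 2 1 : E3)‖ ≤ 2 := by
    refine (norm_add_le _ _).trans ?_
    simp; norm_num
  have : ‖(1 / 2 : ℝ)‖ = 1 / 2 := by norm_num
  rw [this]; linarith

/-- `Φ(x⋆) ≠ 0` (its first component is `¼`). [folklore] -/
theorem Φ_xstar_ne_zero : Φ xstar ≠ 0 := by
  have hχ : (χ : E3 → ℝ) xstar = 1 :=
    χ.one_of_mem_closedBall (by rw [Metric.mem_closedBall, dist_zero_right]; exact norm_xstar_le)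
  have h0 : Φ xstar 0 = 1 / 4 := by
    rw [Φ, PiLp.smul_apply, hχ, A_apply_zero]
    simp [xstar]; norm_num
  intro h
  rw [h] at h0
  simp at h0

/-- `∫|Φ|⁴ > 0`. [folklore] -/
theorem int4_pos : 0 < ∫ x, ‖Φ x‖ ^ 4 := by
  have hc : Continuous fun x : E3 => ‖Φ x‖ ^ 4 := (Φ_contDiff.continuous.norm).pow 4
  have hs : HasCompactSupport fun x : E3 => ‖Φ x‖ ^ 4 :=
    Φ_hasCompactSupport.comp_left (g := fun w : E3 => ‖w‖ ^ 4) (by simp)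
  refine hc.integral_pos_of_hasCompactSupport_nonneg_nonzero hs (fun x => by positivity) (x := xstar) ?_
  exact pow_ne_zero 4 (norm_ne_zero_iff.2 Φ_xstar_ne_zero)

/-- **`¬ Step3_GN_asPrinted C` for EVERY `C` (Step 3 p. 2 l. 26–29, exponents (1,1) AS PRINTED)**: the
dilates `Φ(c·)` of one fixed compactly supported field violate the display for `c` large (the two sides
scale as `c^{-3/2}` and `c^{-2}`). [cite: Alneel2026, Step 3 p.2 l.26–29] -/
theorem not_Step3_GN_asPrinted (C : ℝ) : ¬ Step3_GN_asPrinted C := by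
  intro h
  set A4 : ℝ := ∫ x, ‖Φ x‖ ^ 4 with hA4
  set B2 : ℝ := ∫ x, ‖Φ x‖ ^ 2 with hB2
  set D2 : ℝ := ∫ x, frobeniusNormSq (fderiv ℝ Φ x) with hD2
  have hA : 0 < A4 := int4_pos
  have hB : 0 ≤ B2 := integral_nonneg fun x => by positivity
  have hD : 0 ≤ D2 := integral_nonneg fun x => frobeniusNormSq_nonneg _
  -- the dilation parameter
  set K : ℝ := C ^ 2 * B2 * D2 with hK
  set c : ℝ := |K| / A4 + 1 with hc
  have hc0 : 0 < c := by positivity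
  have hcK : K < c * A4 := by
    have : c * A4 = |K| + A4 := by rw [hc]; field_simp
    rw [this]; linarith [le_abs_self K]
  -- the printed display on the dilate
  have hineq := h (dil c) (dil_contDiff c) (dil_hasCompactSupport hc0.ne')
  rw [int4_dil hc0, int2_dil hc0, intD_dil hc0] at hineq
  have hL : 0 ≤ Real.sqrt ((c ^ 3)⁻¹ * A4) := Real.sqrt_nonneg _
  have h2 := pow_le_pow_left₀ hL hineq 2
  rw [Real.sq_sqrt (by positivity), mul_pow, mul_pow, Real.sq_sqrt (by positivity),
    Real.sq_sqrt (by positivity)] at h2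
  -- h2 : (c ^ 3)⁻¹ * A4 ≤ C ^ 2 * ((c ^ 3)⁻¹ * B2) * (c ^ 2 * ((c ^ 3)⁻¹ * D2))
  have h3 : c * A4 ≤ K := by
    have hc4 : (0 : ℝ) ≤ c ^ 4 := by positivity
    have h4 := mul_le_mul_of_nonneg_right h2 hc4
    have e1 : (c ^ 3)⁻¹ * A4 * c ^ 4 = c * A4 := by field_simp
    have e2 : C ^ 2 * ((c ^ 3)⁻¹ * B2) * (c ^ 2 * ((c ^ 3)⁻¹ * D2)) * c ^ 4 = K := by
      rw [hK]; field_simp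
    rw [e1, e2] at h4
    exact h4
  linarith

/-- **`¬ Step3_GN_asPrinted_ex`**: no finite constant makes the printed Step 3 display true on ℝ³.
[cite: Alneel2026, Step 3 p.2 l.26–29; Remark 4.2 p.3 l.54–55] -/
theorem not_Step3_GN_asPrinted_ex : ¬ Step3_GN_asPrinted_ex :=
  fun ⟨C, h⟩ => not_Step3_GN_asPrinted C h


/-! ### Point 3 of Theorem 3.1 (p. 3 l. 28–49) at the real-function grain: an explicit profile meets every typed hypothesis -/

/-- The blow-up profile of the countermodel to Point 3: `X(s) = (1 − s)^{−1/2}` on `[0,1)`. -/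
def Xw (s : ℝ) : ℝ := (Real.sqrt (1 - s))⁻¹

/-- The radius profile of the countermodel: `R(s)² · X(s) = 32·C` exactly (`R = √(32C/X)`, and `R = 0`
when `C < 0`). -/
def Rw (C : ℝ) (s : ℝ) : ℝ≥0∞ := ENNReal.ofReal (Real.sqrt (16 * C * 2 / Xw s))

/-- `X > 0` on `[0,1)`. [folklore] -/
theorem Xw_pos {s : ℝ} (hs : s < 1) : 0 < Xw s :=
  inv_pos.2 (Real.sqrt_pos.2 (by linarith))

/-- `X` is continuous on `[0,1)`. [folklore] -/
theorem Xw_continuousOn : ContinuousOn Xw (Ico 0 1) := by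
  refine ContinuousOn.inv₀ ((continuous_const.sub continuous_id).sqrt.continuousOn) ?_
  intro s hs
  exact (Real.sqrt_pos.2 (by linarith [hs.2])).ne'

/-- The primitive: `d/ds (−2√(1−s)) = (1−s)^{−1/2}` for `s < 1`. [folklore] -/
theorem hasDerivAt_prim {s : ℝ} (hs : s < 1) :
    HasDerivAt (fun x : ℝ => -2 * Real.sqrt (1 - x)) (Xw s) s := by
  have h1 : HasDerivAt (fun x : ℝ => 1 - x) (-1) s := by
    simpa using (hasDerivAt_id s).const_sub 1
  have hne : (1 : ℝ) - s ≠ 0 := by linarith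
  have h2 := (h1.sqrt hne).const_mul (-2)
  refine h2.congr_deriv ?_
  have hpos : 0 < Real.sqrt (1 - s) := Real.sqrt_pos.2 (by linarith)
  rw [Xw]
  field_simp

/-- `∫₀ᵗ X = 2 − 2√(1−t)` for `t ∈ [0,1)`. [folklore] -/
theorem integral_Xw {t : ℝ} (ht : t ∈ Ico (0:ℝ) 1) :
    ∫ s in (0:ℝ)..t, Xw s = 2 - 2 * Real.sqrt (1 - t) := by
  have hderiv : ∀ x ∈ uIcc (0:ℝ) t, HasDerivAt (fun x : ℝ => -2 * Real.sqrt (1 - x)) (Xw x) x := by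
    intro x hx
    rw [uIcc_of_le ht.1] at hx
    exact hasDerivAt_prim (by linarith [hx.2, ht.2])
  have hint : IntervalIntegrable Xw volume 0 t := by
    refine (Xw_continuousOn.mono ?_).intervalIntegrable
    rw [uIcc_of_le ht.1]
    exact Icc_subset_Ico_right ht.2
  rw [intervalIntegral.integral_eq_sub_of_hasDerivAt hderiv hint]
  simp; ring

/-- The energy budget (4)/Point 2 holds for the profile: `1 · ∫₀ᵗ X ≤ 2`. [folklore] -/
theorem budget_Xw {t : ℝ} (ht : t ∈ Ico (0:ℝ) 1) : (1:ℝ) * ∫ s in (0:ℝ)..t, Xw s ≤ 2 := by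
  rw [one_mul, integral_Xw ht]
  linarith [Real.sqrt_nonneg (1 - t)]

/-- The scale law and its printed reverse hold with EQUALITY along the profile: `R(t)²X(t) = 16·C·2`.
[folklore] -/
theorem scale_eq (C : ℝ) {t : ℝ} (ht : t < 1) :
    Rw C t ^ 2 * ENNReal.ofReal (Xw t) = ENNReal.ofReal (16 * C * 2) := by
  have hX := Xw_pos ht
  rw [Rw, ← ENNReal.ofReal_pow (Real.sqrt_nonneg _)]
  by_cases hC : 0 ≤ C
  · have hq : 0 ≤ 16 * C * 2 / Xw t := by positivity
    rw [Real.sq_sqrt hq, ← ENNReal.ofReal_mul hq, div_mul_cancel₀ _ hX.ne']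
  · have hq : 16 * C * 2 / Xw t ≤ 0 := div_nonpos_of_nonpos_of_nonneg (by linarith [not_le.1 hC]) hX.le
    rw [Real.sqrt_eq_zero'.2 hq, zero_pow two_ne_zero, ENNReal.ofReal_zero, zero_mul,
      ENNReal.ofReal_eq_zero.2 (by linarith [not_le.1 hC])]

/-- `X → +∞` as `s → 1⁻`. [folklore] -/
theorem tendsto_Xw : Tendsto Xw (𝓝[<] (1:ℝ)) atTop := by
  have h1 : Tendsto (fun s : ℝ => Real.sqrt (1 - s)) (𝓝[<] (1:ℝ)) (𝓝[>] 0) := by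
    refine tendsto_nhdsWithin_iff.2 ⟨?_, ?_⟩
    · have hc : Continuous fun s : ℝ => Real.sqrt (1 - s) := (continuous_const.sub continuous_id).sqrt
      have := (hc.tendsto (1:ℝ)).mono_left (nhdsWithin_le_nhds (s := Iio (1:ℝ)))
      simpa using this
    · exact eventually_nhdsWithin_of_forall fun s hs => Real.sqrt_pos.2 (sub_pos.2 hs)
  exact tendsto_inv_nhdsGT_zero.comp h1

/-- **`¬ Step_P3tail C` for EVERY `C` (Point 3, p. 3 l. 28–49, real-function grain)**: the profile
`ν = 1`, `E₀ = 2`, `T* = 1`, `X(s) = (1−s)^{−1/2}`, `R(s)²X(s) ≡ 32C` satisfies every typed hypothesis of the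
printed tail — (4), the scale law, the printed reverse law, `X → ∞` — so the printed inference «R ≥ c√(T*−s)
… ∫X = ∞ … E(T*) < 0» does not follow. [cite: Alneel2026, Point 3 p.3 l.28–49] -/
theorem not_Step_P3tail (C : ℝ) : ¬ Step_P3tail C := fun h =>
  h 1 2 1 Xw (Rw C) one_pos (by norm_num) one_pos Xw_continuousOn (fun t ht => (Xw_pos ht.2).le)
    (fun t ht => budget_Xw ht) (fun t ht => (scale_eq C ht.2).le) (fun t ht => (scale_eq C ht.2).ge)
    tendsto_Xw

/-- **`¬ Step_Thm31_inference C` for EVERY `C`** (abstract p. 1 l. 18–20 / §5 p. 3 l. 57–59: «scale law +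
energy identity excludes blow-up», real-function grain): same profile. [cite: Alneel2026, abstract p.1
l.18–20; §5 p.3 l.57–59] -/
theorem not_Step_Thm31_inference (C : ℝ) : ¬ Step_Thm31_inference C :=
  fun h => not_Step_P3tail C (p3tail_of_inference C h)

end Summit.NavierStokesRegularity.NavierStokesRegularity.Theorems.Alneel2026

end

-- WHAT THIS IS NOT: not a claim about NS regularity or blow-up; not a claim about any author beyond the
-- typed locator.
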